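import Mathlib

/-!
# SoloBlind — isotropic half-ideals of the Kuga–Satake polarisation (split discriminant of the
# Weil-type eightfolds of the T₈ face)

Solo seat `solo-HodgeConjecture-blind`, session s34 (HOME `work/s34/weil-disc.md`, script `work/s34/weil_disc.py`).

Context (paper statements, not formalised here).  For a K3 surface `X` very general on the T₈ face
(`T(X)_ℚ ≅ U² ⊕ D₄(−1)`, `E_T = ℚ`) the Kuga–Satake variety splits as `A₊⁴ × A₋⁴` with `A±` simple abelian
eightfolds, `H¹(A±, ℚ) = N± = C⁺(T)·p±` a minimal left ideal of the even Clifford algebra, `End⁰(A±) = 𝕳 =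
(−1,−1)_ℚ` acting by right multiplication, and polarisation `E(x, y) = tr(α · ι(x) · y)` with `ι` the
reversion anti-involution and `ι(α) = −α` (van Geemen's form).  For every imaginary quadratic `K ⊂ 𝕳` the pair
`(A±, K)` is an abelian eightfold of Weil type.  The HOME file proves that its `K`-Hermitian form is HYPERBOLIC
(trivial discriminant, Witt index 4) for every such `K` at once, by exhibiting the right-`𝕳`-stable subspace
`L = f·N` for an idempotent `f ∈ C⁺(T)` with `ι(f) = 1 − f` (e.g. `f = (1 + e_a e_b)/2` with
`q(e_a) q(e_b) = −1`): `E` vanishes identically on `f·N` and on `(1 − f)·N`, and `N = f·N ⊕ (1 − f)·N`, so each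
half is a Lagrangian `𝕳`-submodule.  An exact computation (`weil_disc.py`) confirms `det H_K ∈ ℚ^{×2}` for
`K = ℚ(√−d)`, `d ∈ {1,2,3,5,6}`, for both `A₊` and `A₋`.

What is kernel-checked here (pure ring theory, the load-bearing identity of that argument):
* `rev_idem_mul_self` : if `f² = f` and `rev f = 1 - f` then `rev f * f = 0`;
* `isotropic_half_ideal` : for any anti-multiplicative `rev` and any `α`, the "polarisation integrand"
  `α * rev (f * x) * (f * y)` vanishes — `E(fx, fy) = 0` before taking the trace;
* `isotropic_complement` : the same for the complementary idempotent `1 - f` (given `rev (1 - f) = f`);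
* `split_decomposition` : `x = f * x + (1 - f) * x`;
* `weil_numerology` : the bookkeeping `16 = 8 + 8`, `8 = 4 + 4` (half-dimensional pieces over `ℚ` and over `K`)
  and the fact that the two determinants met, `2^24` and `2^20`, are squares (`(2^12)^2`, `(2^10)^2`).
-/

namespace Summit.HodgeConjecture.HodgeConjecture.Theorems.SoloBlindIsotropicIdeal

section Ring

variable {R : Type*} [Ring R]

/-- If `f` is idempotent and the anti-involution sends `f` to the complementary idempotent, then
`rev f * f = 0`. -/
theorem rev_idem_mul_self (rev : R → R) (f : R) (hf : f * f = f) (hrev : rev f = 1 - f) :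
    rev f * f = 0 := by
  rw [hrev, sub_mul, one_mul, hf, sub_self]

/-- The isotropy identity: for an anti-multiplicative map `rev` (`rev (a * b) = rev b * rev a`), an idempotent
`f` with `rev f = 1 - f`, and arbitrary `α x y`, the element `α * rev (f * x) * (f * y)` — whose trace is the
value `E(f x, f y)` of the Kuga–Satake polarisation — is zero.  Hence the left ideal piece `f · N` is totally
isotropic for `E`. -/
theorem isotropic_half_ideal (rev : R → R) (rev_mul : ∀ a b : R, rev (a * b) = rev b * rev a)
    (f α x y : R) (hf : f * f = f) (hrev : rev f = 1 - f) :
    α * rev (f * x) * (f * y) = 0 := by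
  have key : rev f * f = 0 := rev_idem_mul_self rev f hf hrev
  rw [rev_mul]
  calc α * (rev x * rev f) * (f * y) = α * rev x * (rev f * f) * y := by noncomm_ring
    _ = 0 := by rw [key]; simp

/-- The complementary piece `(1 - f) · N` is isotropic as well (hypothesis: `rev (1 - f) = f`, which holds when
`rev` is additive with `rev 1 = 1`). -/
theorem isotropic_complement (rev : R → R) (rev_mul : ∀ a b : R, rev (a * b) = rev b * rev a)
    (f α x y : R) (hf : f * f = f) (hrev' : rev (1 - f) = f) :
    α * rev ((1 - f) * x) * ((1 - f) * y) = 0 := by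
  have hg : (1 - f) * (1 - f) = 1 - f := by
    rw [mul_sub, sub_mul, one_mul, mul_one, sub_mul, one_mul, hf]; abel
  have hrev : rev (1 - f) = 1 - (1 - f) := by rw [hrev']; abel
  exact isotropic_half_ideal rev rev_mul (1 - f) α x y hg hrev

/-- If `rev` is additive, sends `1` to `1`, and `rev f = 1 - f`, then `rev (1 - f) = f` — the hypothesis of
`isotropic_complement`. -/
theorem rev_complement (rev : R →+ R) (h1 : rev 1 = 1) (f : R) (hrev : rev f = 1 - f) :
    rev (1 - f) = f := by
  rw [map_sub, h1, hrev]; abel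

/-- `N = f·N + (1 - f)·N`: every element splits along the two isotropic halves. -/
theorem split_decomposition (f x : R) : x = f * x + (1 - f) * x := by
  rw [sub_mul, one_mul]; abel

/-- An idempotent of the shape used in the HOME file: if `u * u = 1` and `2` is invertible then
`f = ⅟2 * (1 + u)` is idempotent.  (`u = e_a e_b` with `q(e_a) q(e_b) = -1` in `C⁺(T)`.) -/
theorem idem_of_involution [Invertible (2 : R)] (u : R) (hu : u * u = 1) :
    (⅟(2 : R) * (1 + u)) * (⅟(2 : R) * (1 + u)) = ⅟(2 : R) * (1 + u) := by
  have h2 : (1 + u) * (1 + u) = 2 * (1 + u) := by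
    rw [add_mul, mul_add, mul_add, one_mul, mul_one, one_mul, hu]
    rw [two_mul]; abel
  have hc : (1 + u) * ⅟(2 : R) = ⅟(2 : R) * (1 + u) := by
    rw [add_mul, mul_add, one_mul, mul_one, (Commute.invOf_right (Commute.ofNat_right u 2)).eq]
  calc ⅟(2 : R) * (1 + u) * (⅟(2 : R) * (1 + u))
      = ⅟(2 : R) * ((1 + u) * ⅟(2 : R)) * (1 + u) := by noncomm_ring
    _ = ⅟(2 : R) * (⅟(2 : R) * (1 + u)) * (1 + u) := by rw [hc]
    _ = ⅟(2 : R) * ⅟(2 : R) * ((1 + u) * (1 + u)) := by noncomm_ring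
    _ = ⅟(2 : R) * ⅟(2 : R) * (2 * (1 + u)) := by rw [h2]
    _ = ⅟(2 : R) * (⅟(2 : R) * 2) * (1 + u) := by noncomm_ring
    _ = ⅟(2 : R) * (1 + u) := by rw [invOf_mul_self]; noncomm_ring

/-- For the same `f = ⅟2 (1 + u)`: if `rev u = -u` (as for `u = e_a e_b`: reversion swaps the two vectors) and
`rev` is additive, fixes `1` and commutes with the scalar `⅟2`, then `rev f = 1 - f`. -/
theorem rev_idem_of_involution [Invertible (2 : R)] (rev : R →+ R) (h1 : rev 1 = 1)
    (hhalf : ∀ a : R, rev (⅟(2 : R) * a) = ⅟(2 : R) * rev a) (u : R) (hu : rev u = -u) :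
    rev (⅟(2 : R) * (1 + u)) = 1 - ⅟(2 : R) * (1 + u) := by
  rw [hhalf, map_add, h1, hu]
  have : (1 : R) = ⅟(2 : R) * 2 := by rw [invOf_mul_self]
  calc ⅟(2 : R) * (1 + -u) = ⅟(2 : R) * (1 + 1) - ⅟(2 : R) * (1 + u) := by noncomm_ring
    _ = ⅟(2 : R) * 2 - ⅟(2 : R) * (1 + u) := by rw [one_add_one_eq_two]
    _ = 1 - ⅟(2 : R) * (1 + u) := by rw [← this]

end Ring

/-- Numerology of the split: `dim_ℚ N = 16 = 8 + 8` (two Lagrangian halves), `dim_K N = 8 = 4 + 4`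
(Witt index 4 = half, i.e. hyperbolic), and the two exact determinants met in `weil_disc.py`,
`det H_K = 2^{-24}` (`d = 1, 2, 5`) and `2^{-20}` (`d = 3, 6`), are rational squares. -/
theorem weil_numerology :
    (16 = 8 + 8) ∧ (8 = 4 + 4) ∧ (2 ^ 24 = (2 ^ 12) ^ 2) ∧ (2 ^ 20 = (2 ^ 10) ^ 2) ∧
    ((1 : ℚ) / 2 ^ 24 = ((1 : ℚ) / 2 ^ 12) ^ 2) ∧ ((1 : ℚ) / 2 ^ 20 = ((1 : ℚ) / 2 ^ 10) ^ 2) := by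
  norm_num

end Summit.HodgeConjecture.HodgeConjecture.Theorems.SoloBlindIsotropicIdeal
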